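import Summits.HodgeConjecture.HodgeConjecture.Theorems.MarkmanPartnerTransportPicardThreeK3SquaresSimilitudeTranspose
import Summits.HodgeConjecture.HodgeConjecture.Theorems.MarkmanPartnerTransportPicardThreeK3SquaresTranscendentalBuskin
import Summits.HodgeConjecture.HodgeConjecture.Theorems.MarkmanPartnerTransportPicardThreeK3SquaresCyclotomicCM
import Summits.HodgeConjecture.HodgeConjecture.Theorems.PgOneCyclotomicSquaresTranscendental

/-!
# Route MarkmanPartnerTransport · crux `PicardThreeK3Squares` (stmt-HodgeConjecture-19652) —
# Varesco's Thm. 2.1 IN THE KERNEL: a Hodge similitude `√m` of `T(X)` is cycle-induced as soon as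
# some projective K3 surface admits an ALGEBRAIC similitude of multiplier `m` onto `T(X)`

This is the proof of Varesco's Thm. 2.1 (Math. Z. 305 (2023), p. 8: "The composition
`(1/p)·ψ ∘ φ : T(Y) → T(X)` is then a Hodge isometry. Therefore, by [Buskin, Huybrechts], it is
algebraic, and we conclude that `ψ` is algebraic."), carried out on the tree's real carriers and with
the hypothesis "`X` has a symplectic automorphism of order `p`" replaced by exactly what the proof uses
of it — the DATUM of a marked projective K3 surface `Y` and an algebraic class `γ` on `X ⊗ Y` whose
action `φ = [γ]_* = fst_*(snd^*(·) ∪ γ)` is rational, Hodge-type preserving, maps `T(Y)` ONTO `T(X)`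
and scales the intersection forms by `m` there (for `p ∈ {2, 3}` under the lattice criteria of
Prop. 2.5 / 2.11 this datum is the tree's named fact
`Varesco2023_quotientSimilitude_two/three_of_transcendental_embedding`; here `m ∈ ℕ` is arbitrary).

* `cycleInduced_of_algebraicSimilitude` — **for a marked projective K3 surface `(X, η, p, x)`, such a
  datum `(Y, γ)` of multiplier `m ≠ 0`, and `ψ` mapping `T(X)` to itself, rational and type-preserving
  there, with `ψ² = m` and multiplier `m` on `T(X)`: some algebraic class on `X ⊗ X` acts as `ψ` on
  `T(X)`** (complex orientations), modulo `Buskin2019_hodgeIsometry_algebraic` ONLY. Proof: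
  `u := m⁻¹ · ψ ∘ φ : H²(Y) → H²(X)` maps `T(Y)` onto `T(X)`, is rational there, is an ISOMETRY in the
  markings (`m⁻² · m · m = 1`) and carries the period line of `Y` into that of `X`; so `u = [γ_u]_*` on
  `T(Y)` for an algebraic `γ_u` (Buskin–Huybrechts in the transcendental form, REDUCED to Buskin in the
  tree: `NikulinIsogeny.transcendentalHodgeIsometry_algebraic_of_buskin`); the transpose `ᵗφ = [ᵗγ]_*`
  is algebraic, maps `T(X) → T(Y)` and `φ ∘ ᵗφ = c` on `T(X)` with `c = m·∫p_X/∫p_Y ≠ 0`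
  (`SimilitudeTranspose.comp_transpose_eq_smul`); hence `[γ_u ∘ ᵗγ]_* = u ∘ ᵗφ = (c/m)·ψ` on `T(X)`.

No definition, no sorry. Prover seat hodge-nonav-19652-p1 (gen 5), `--supports stmt-HodgeConjecture-19652`.

References: M. Varesco, Math. Z. 305 (2023) art. 69, §2 (starting observation) and Thm. 2.1 (proof);
N. Buskin, J. reine angew. Math. 755 (2019) Thm. 1.1; D. Huybrechts, Comment. Math. Helv. 94 (2019)
Cor. 0.4 (i); B. Kahn, *Zeta and L-functions of varieties and motives*, §3.5.3 Lemma 3.48.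
-/

set_option linter.dupNamespace false

noncomputable section

namespace Summit.HodgeConjecture.HodgeConjecture.Theorems.MarkmanPartnerTransport.QuotientSimilitude

open scoped Manifold
open Module CategoryTheory MonoidalCategory CartesianMonoidalCategory
open Literature.AlgebraicGeometry Literature.AlgebraicGeometry.Motives Literature.AlgebraicGeometry.HodgeTheory
open Literature.AlgebraicGeometry.Surfaces
open Literature.AlgebraicTopology.SingularHomology
open Summit.HodgeConjecture.HodgeConjecture.Theorems
open Summit.HodgeConjecture.HodgeConjecture.Theorems.NikulinTwinTransport
open Summit.HodgeConjecture.HodgeConjecture.Theorems.NikulinTwinTransport.SquareGlueFree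
open Summit.HodgeConjecture.HodgeConjecture.Theorems.MarkmanPartnerTransport
open Summit.HodgeConjecture.HodgeConjecture.Theorems.MarkmanPartnerTransport.SimilitudeTranspose

variable {S : SchemeOver ℂ}

/-- `MarkedK3[S, η, p, x]`: VERBATIM the `let MarkedK3 := …` binder of the route declaration
`PicardThreeK3Squares`. Local notation only. -/
local notation3 (prettyPrint := false) "MarkedK3[" S ", " η ", " p ", " x "]" =>
  (p ≠ 0 ∧ (IsIntegralClass p ∧
    (∀ q : complexBetti S (2 * 2), IsIntegralClass q → ∃ n : ℤ, q = n • p) ∧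
    (∀ c : complexBetti S (2 * 1), IsIntegralClass c ↔ ∃ v : K3Index → ℤ, η c = fun i => (v i : ℂ)) ∧
    (∀ a b : complexBetti S (2 * 1),
      cupProduct (rfl : 2 * 1 + 2 * 1 = 2 * 2) a b = k3Form (η a) (η b) • p) ∧
    IsOfHodgeType 2 S (2 * 1) 2 0 (LinearEquiv.symm η x) ∧
    (∀ τ : complexBetti S (2 * 1), IsOfHodgeType 2 S (2 * 1) 2 0 τ →
      ∃ t : ℂ, τ = t • LinearEquiv.symm η x)) ∧
    (k3Form x x = 0 ∧ 0 < (k3Form (star x) x).re ∧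
      ∃ u : K3Index → ℤ, k3Form (fun i => (u i : ℂ)) x = 0 ∧ 0 < ∑ i, ∑ j, u i * k3Gram i j * u j))

/-- `Corr[μ, X, Y, hX, hY ; γ, y] = fst_* (snd^* y ∪ γ)` (`hX hY : IsSmoothProjective 2 _`). Local notation only. -/
local notation3 (prettyPrint := false) "Corr[" μ ", " X ", " Y ", " hX ", " hY " ; " γ ", " y "]" =>
  complexGysin μ (IsSmoothProjective.tensor_holds hX hY) hX (SemiCartesianMonoidalCategory.fst X Y)
    (rfl : 2 * 1 + 2 * 2 + 2 * 2 = 2 * 1 + 2 * (2 + 2))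
    (cupProduct (rfl : 2 * 1 + 2 * 2 = 2 * 1 + 2 * 2)
      (complexBetti.map (SemiCartesianMonoidalCategory.snd X Y) (2 * 1) y) γ)

/-- `Transp[X, Y ; γ] = swap^* γ`. Local notation only. -/
local notation3 (prettyPrint := false) "Transp[" X ", " Y " ; " γ "]" =>
  complexBetti.map (CartesianMonoidalCategory.lift (SemiCartesianMonoidalCategory.snd Y X)
    (SemiCartesianMonoidalCategory.fst Y X)) (2 * 2) γ

/-! ### The core theorem -/

/-- **Varesco's Thm. 2.1, abstract form: `√m` is cycle-induced whenever an algebraic similitude of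
multiplier `m` onto `T(X)` exists.** Let `(X, η, p, x)` and `(Y, η_Y, p_Y, x_Y)` be marked projective
K3 surfaces, `γ` an algebraic class on `X ⊗ Y` whose action `φ = [γ]_*` (complex orientations) is
rational, Hodge-type preserving, maps `T(Y)` onto `T(X)` with `(ηφa · ηφb) = m (η_Y a · η_Y b)`
there (`m ∈ ℕ`, `m ≠ 0`), and `ψ` an endomorphism of `H²(X(ℂ); ℂ)` mapping `T(X)` to itself,
rational and type-preserving there, with `ψ² = m` and multiplier `m` on `T(X)`. Then, granted
`Buskin2019_hodgeIsometry_algebraic`, some algebraic class on `X ⊗ X` acts as `ψ` on `T(X)`. Proof in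
the module docstring (`u = m⁻¹ ψφ` is a rational Hodge isometry `T(Y) ⥲ T(X)`, algebraic by
Buskin–Huybrechts; `ψ = (m/c)·u ∘ ᵗφ` on `T(X)`). [cite: Varesco2023, §2 Thm. 2.1 (proof, p. 8)]
[cite: Huybrechts2019, Cor. 0.4 (i)] [cite: Kahn2020, §3.5.3 Lemma 3.48] -/
theorem cycleInduced_of_algebraicSimilitude (hB : Buskin2019_hodgeIsometry_algebraic)
    (hS : IsK3Surface S)
    (η : complexBetti S (2 * 1) ≃ₗ[ℂ] (K3Index → ℂ)) (p : complexBetti S (2 * 2)) (x : K3Index → ℂ)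
    (hM : MarkedK3[S, η, p, x])
    {Y : SchemeOver ℂ} (hY : IsK3Surface Y)
    (ηY : complexBetti Y (2 * 1) ≃ₗ[ℂ] (K3Index → ℂ)) (pY : complexBetti Y (2 * 2)) (xY : K3Index → ℂ)
    (hMY : MarkedK3[Y, ηY, pY, xY])
    (γ : complexBetti (S ⊗ Y) (2 * 2)) (hγalg : γ ∈ algebraicClasses (S ⊗ Y) 2)
    (hφrat : ∀ y, IsRationalClass y →
      IsRationalClass (Corr[complexOrientationFamily, S, Y, hS.1, hY.1 ; γ, y]))
    (hφtyp : ∀ (i j : ℕ) y, IsOfHodgeType 2 Y (2 * 1) i j y →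
      IsOfHodgeType 2 S (2 * 1) i j (Corr[complexOrientationFamily, S, Y, hS.1, hY.1 ; γ, y]))
    (hφT : ∀ y ∈ transcendentalSubspace Y,
      Corr[complexOrientationFamily, S, Y, hS.1, hY.1 ; γ, y] ∈ transcendentalSubspace S)
    (hφonto : ∀ z ∈ transcendentalSubspace S, ∃ y ∈ transcendentalSubspace Y,
      Corr[complexOrientationFamily, S, Y, hS.1, hY.1 ; γ, y] = z)
    {m : ℕ} (hm : m ≠ 0)
    (hφmul : ∀ a ∈ transcendentalSubspace Y, ∀ b ∈ transcendentalSubspace Y,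
      k3Form (η (Corr[complexOrientationFamily, S, Y, hS.1, hY.1 ; γ, a]))
        (η (Corr[complexOrientationFamily, S, Y, hS.1, hY.1 ; γ, b])) = (m : ℂ) * k3Form (ηY a) (ηY b))
    (ψ : complexBetti S (2 * 1) →ₗ[ℂ] complexBetti S (2 * 1))
    (hψT : Set.MapsTo ψ (transcendentalSubspace S) (transcendentalSubspace S))
    (hψrat : ∀ y ∈ transcendentalSubspace S, IsRationalClass y → IsRationalClass (ψ y))
    (hψtyp : ∀ (i j : ℕ), ∀ y ∈ transcendentalSubspace S,
      IsOfHodgeType 2 S (2 * 1) i j y → IsOfHodgeType 2 S (2 * 1) i j (ψ y))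
    (hψsq : ∀ y ∈ transcendentalSubspace S, ψ (ψ y) = (m : ℂ) • y)
    (hψmul : ∀ y ∈ transcendentalSubspace S, ∀ z ∈ transcendentalSubspace S,
      cupProduct (rfl : 2 * 1 + 2 * 1 = 2 * 2) (ψ y) (ψ z) =
        (m : ℂ) • cupProduct (rfl : 2 * 1 + 2 * 1 = 2 * 2) y z) :
    ∃ γ' ∈ algebraicClasses (S ⊗ S) 2, ∀ z ∈ transcendentalSubspace S,
      Corr[complexOrientationFamily, S, S, hS.1, hS.1 ; γ', z] = ψ z := by
  classical
  have h4 : 2 * 1 + 2 * 1 = 2 * 2 := rfl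
  have hm0 : (m : ℂ) ≠ 0 := Nat.cast_ne_zero.2 hm
  have hM' := hM
  obtain ⟨hp₀, ⟨hpint, hpgen, hηint, hηcup, hx20, hxline⟩, -⟩ := hM'
  have hMY' := hMY
  obtain ⟨hpY0, ⟨hpYint, -, -, hηYcup, hxY20, hxYline⟩, -⟩ := hMY'
  have hsmul0 : ∀ {c : ℂ}, c • p = 0 → c = 0 := fun h => by
    rcases smul_eq_zero.1 h with h | h
    · exact h
    · exact absurd h hp₀
  -- `ψ` has multiplier `m` in the marking
  have hψk3 : ∀ a ∈ transcendentalSubspace S, ∀ b ∈ transcendentalSubspace S,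
      k3Form (η (ψ a)) (η (ψ b)) = (m : ℂ) * k3Form (η a) (η b) := by
    intro a ha b hb
    have h := hψmul a ha b hb
    rw [hηcup, hηcup, smul_smul] at h
    have h2 : (k3Form (η (ψ a)) (η (ψ b)) - (m : ℂ) * k3Form (η a) (η b)) • p = 0 := by
      rw [sub_smul, h, sub_self]
    exact sub_eq_zero.1 (hsmul0 h2)
  -- `φ` and its transpose as linear maps
  set φ : complexBetti Y (2 * 1) →ₗ[ℂ] complexBetti S (2 * 1) :=
    (complexGysin complexOrientationFamily (IsSmoothProjective.tensor_holds hS.1 hY.1) hS.1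
        (SemiCartesianMonoidalCategory.fst S Y) (rfl : 2 * 1 + 2 * 2 + 2 * 2 = 2 * 1 + 2 * (2 + 2))) ∘ₗ
      ((cupProduct (rfl : 2 * 1 + 2 * 2 = 2 * 1 + 2 * 2)).flip γ) ∘ₗ
      (complexBetti.map (SemiCartesianMonoidalCategory.snd S Y) (2 * 1)).hom with hφdef
  have hφ : ∀ y, φ y = Corr[complexOrientationFamily, S, Y, hS.1, hY.1 ; γ, y] := fun y ↦ rfl
  set φt : complexBetti S (2 * 1) →ₗ[ℂ] complexBetti Y (2 * 1) :=
    (complexGysin complexOrientationFamily (IsSmoothProjective.tensor_holds hY.1 hS.1) hY.1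
        (SemiCartesianMonoidalCategory.fst Y S) (rfl : 2 * 1 + 2 * 2 + 2 * 2 = 2 * 1 + 2 * (2 + 2))) ∘ₗ
      ((cupProduct (rfl : 2 * 1 + 2 * 2 = 2 * 1 + 2 * 2)).flip (Transp[S, Y ; γ])) ∘ₗ
      (complexBetti.map (SemiCartesianMonoidalCategory.snd Y S) (2 * 1)).hom with hφtdef
  have hφt : ∀ w, φt w = Corr[complexOrientationFamily, Y, S, hY.1, hS.1 ; Transp[S, Y ; γ], w] :=
    fun w ↦ rfl
  have hφtyp' : ∀ y, IsOfHodgeType 2 Y (2 * 1) 1 1 y →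
      IsOfHodgeType 2 S (2 * 1) 1 1 (Corr[complexOrientationFamily, S, Y, hS.1, hY.1 ; γ, y]) :=
    fun y hy ↦ hφtyp 1 1 y hy
  -- the constant `c = m · ∫p_X / ∫p_Y`
  set c : ℂ := (m : ℂ) * traceC hS.1 p * (traceC hY.1 pY)⁻¹ with hcdef
  have hτS : traceC hS.1 p ≠ 0 := fun h ↦ hp₀ (eq_zero_of_traceC_eq_zero hS.1 h)
  have hτY : traceC hY.1 pY ≠ 0 := fun h ↦ hpY0 (eq_zero_of_traceC_eq_zero hY.1 h)
  have hc0 : c ≠ 0 := by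
    rw [hcdef]
    exact mul_ne_zero (mul_ne_zero hm0 hτS) (inv_ne_zero hτY)
  -- `φ ᵗφ = c` on `T(X)`; `ᵗφ` maps `T(X) → T(Y)`
  have key : ∀ z ∈ transcendentalSubspace S, φ (φt z) = c • z := fun z hz ↦ by
    rw [hφt, hφ]
    exact comp_transpose_eq_smul hS.1 hY.1 η p ηY pY hpY0 hηcup hηYcup γ hφrat hφtyp' hφT hφonto
      hφmul hz
  have hφtT : ∀ z ∈ transcendentalSubspace S, φt z ∈ transcendentalSubspace Y := fun z hz ↦ by
    rw [hφt]
    exact transpose_mem_transcendentalSubspace hS.1 hY.1 γ hφrat hφtyp' hz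
  -- the Hodge isometry `u = m⁻¹ · ψ ∘ φ : H²(Y) → H²(X)`
  set u : complexBetti Y (2 * 1) →ₗ[ℂ] complexBetti S (2 * 1) := ((m : ℂ))⁻¹ • (ψ ∘ₗ φ) with hudef
  have hu : ∀ y, u y = ((m : ℂ))⁻¹ • ψ (φ y) := fun y ↦ rfl
  have huT : ∀ y ∈ transcendentalSubspace Y, u y ∈ transcendentalSubspace S := fun y hy ↦ by
    rw [hu]
    exact Submodule.smul_mem _ _ (hψT (hφT y hy))
  have huonto : ∀ z ∈ transcendentalSubspace S, ∃ y ∈ transcendentalSubspace Y, u y = z := by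
    intro z hz
    obtain ⟨y, hy, hyz⟩ := hφonto _ (hψT hz)
    refine ⟨y, hy, ?_⟩
    rw [hu, hφ, hyz, hψsq z hz, smul_smul, inv_mul_cancel₀ hm0, one_smul]
  have hurat : ∀ y ∈ transcendentalSubspace Y, IsRationalClass y → IsRationalClass (u y) := by
    intro y hyT hy
    have hκ : (((m : ℚ)⁻¹ : ℚ) : ℂ) = ((m : ℂ))⁻¹ := by push_cast; rfl
    rw [hu, ← hκ]
    exact (hψrat _ (hφT y hyT) (by rw [← hφ]; exact hφrat y hy)).smul _
  have huiso : ∀ a ∈ transcendentalSubspace Y, ∀ b ∈ transcendentalSubspace Y,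
      k3Form (η (u a)) (η (u b)) = k3Form (ηY a) (ηY b) := by
    intro a ha b hb
    have hA : φ a ∈ transcendentalSubspace S := hφT a ha
    have hB' : φ b ∈ transcendentalSubspace S := hφT b hb
    rw [hu, hu, map_smul, map_smul, k3Form_smul_left, k3Form_smul_right, hψk3 _ hA _ hB', hφ, hφ,
      hφmul a ha b hb]
    field_simp
  -- the period line: `u(η_Y⁻¹ x_Y) ∈ ℂ · η⁻¹ x`
  have hωYT : ηY.symm xY ∈ transcendentalSubspace Y :=
    (mem_transcendentalSubspace_iff_forall_algebraicClasses hY.1 _).2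
      fun d hd ↦ PgOneCyclotomicSquares.cup_eq_zero_of_twoZero hY.1 hxY20 hd
  have huline : ∃ t : ℂ, u (ηY.symm xY) = t • η.symm x := by
    have h1 : IsOfHodgeType 2 S (2 * 1) 2 0 (φ (ηY.symm xY)) := by
      rw [hφ]
      exact hφtyp 2 0 _ hxY20
    obtain ⟨t, ht⟩ := hxline _ (hψtyp 2 0 _ (hφT _ hωYT) h1)
    refine ⟨((m : ℂ))⁻¹ * t, ?_⟩
    rw [hu, hφ, ht, smul_smul]
  -- Buskin–Huybrechts: `u` is induced on `T(Y)` by an algebraic class on `X ⊗ Y`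
  have hH : Huybrechts2019_transcendentalHodgeIsometry_algebraic :=
    NikulinIsogeny.transcendentalHodgeIsometry_algebraic_of_buskin hB
  obtain ⟨γu, hγualg, hγu⟩ := hH hS hY η p x ηY pY xY hM hMY u huT huonto hurat huiso huline
  -- compose with the algebraic transpose `ᵗγ`
  have hCUP := SquareOfGenerator.cupProduct_mem_algebraicClasses_tripleProduct
  have hγtalg : Transp[S, Y ; γ] ∈ algebraicClasses (Y ⊗ S) 2 :=
    transpose_mem_algebraicClasses hS.1 hY.1 hγalg
  obtain ⟨γB, hγBalg, hγB⟩ := corrComp_K3_of_cup complexOrientationFamily hCUP S Y S hS hY hS γu hγualg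
    (Transp[S, Y ; γ]) hγtalg
  -- evaluate on `T(X)`: `[γB]_* z = u (ᵗφ z) = m⁻¹ ψ (c z)`
  have hBval : ∀ z ∈ transcendentalSubspace S,
      Corr[complexOrientationFamily, S, S, hS.1, hS.1 ; γB, z] = (((m : ℂ))⁻¹ * c) • ψ z := by
    intro z hz
    have hzt : φt z ∈ transcendentalSubspace Y := hφtT z hz
    rw [hγB z, ← hφt, ← hγu _ hzt, hu, key z hz, map_smul, smul_smul]
  refine ⟨((m : ℂ) * c⁻¹) • γB, Submodule.smul_mem _ _ hγBalg, fun z hz ↦ ?_⟩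
  rw [map_smul, map_smul, hBval z hz, smul_smul]
  have h : (m : ℂ) * c⁻¹ * (((m : ℂ))⁻¹ * c) = 1 := by field_simp
  rw [h, one_smul]

/-- **Global-hypotheses form** of `cycleInduced_of_algebraicSimilitude`: the same conclusion when `ψ` is
assumed rational and Hodge-type preserving on all of `H²(X(ℂ); ℂ)` (the shape in which real
multiplications are usually given, e.g. in `…SqrtNatSector`); restriction to `T(X)`.
[cite: Varesco2023, §2 Thm. 2.1 (proof, p. 8)] -/
theorem cycleInduced_of_algebraicSimilitude' (hB : Buskin2019_hodgeIsometry_algebraic)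
    (hS : IsK3Surface S)
    (η : complexBetti S (2 * 1) ≃ₗ[ℂ] (K3Index → ℂ)) (p : complexBetti S (2 * 2)) (x : K3Index → ℂ)
    (hM : MarkedK3[S, η, p, x])
    {Y : SchemeOver ℂ} (hY : IsK3Surface Y)
    (ηY : complexBetti Y (2 * 1) ≃ₗ[ℂ] (K3Index → ℂ)) (pY : complexBetti Y (2 * 2)) (xY : K3Index → ℂ)
    (hMY : MarkedK3[Y, ηY, pY, xY])
    (γ : complexBetti (S ⊗ Y) (2 * 2)) (hγalg : γ ∈ algebraicClasses (S ⊗ Y) 2)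
    (hφrat : ∀ y, IsRationalClass y →
      IsRationalClass (Corr[complexOrientationFamily, S, Y, hS.1, hY.1 ; γ, y]))
    (hφtyp : ∀ (i j : ℕ) y, IsOfHodgeType 2 Y (2 * 1) i j y →
      IsOfHodgeType 2 S (2 * 1) i j (Corr[complexOrientationFamily, S, Y, hS.1, hY.1 ; γ, y]))
    (hφT : ∀ y ∈ transcendentalSubspace Y,
      Corr[complexOrientationFamily, S, Y, hS.1, hY.1 ; γ, y] ∈ transcendentalSubspace S)
    (hφonto : ∀ z ∈ transcendentalSubspace S, ∃ y ∈ transcendentalSubspace Y,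
      Corr[complexOrientationFamily, S, Y, hS.1, hY.1 ; γ, y] = z)
    {m : ℕ} (hm : m ≠ 0)
    (hφmul : ∀ a ∈ transcendentalSubspace Y, ∀ b ∈ transcendentalSubspace Y,
      k3Form (η (Corr[complexOrientationFamily, S, Y, hS.1, hY.1 ; γ, a]))
        (η (Corr[complexOrientationFamily, S, Y, hS.1, hY.1 ; γ, b])) = (m : ℂ) * k3Form (ηY a) (ηY b))
    (ψ : complexBetti S (2 * 1) →ₗ[ℂ] complexBetti S (2 * 1))
    (hψT : Set.MapsTo ψ (transcendentalSubspace S) (transcendentalSubspace S))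
    (hψrat : ∀ y, IsRationalClass y → IsRationalClass (ψ y))
    (hψtyp : ∀ (i j : ℕ) y, IsOfHodgeType 2 S (2 * 1) i j y → IsOfHodgeType 2 S (2 * 1) i j (ψ y))
    (hψsq : ∀ y ∈ transcendentalSubspace S, ψ (ψ y) = (m : ℂ) • y)
    (hψmul : ∀ y ∈ transcendentalSubspace S, ∀ z ∈ transcendentalSubspace S,
      cupProduct (rfl : 2 * 1 + 2 * 1 = 2 * 2) (ψ y) (ψ z) =
        (m : ℂ) • cupProduct (rfl : 2 * 1 + 2 * 1 = 2 * 2) y z) :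
    ∃ γ' ∈ algebraicClasses (S ⊗ S) 2, ∀ z ∈ transcendentalSubspace S,
      Corr[complexOrientationFamily, S, S, hS.1, hS.1 ; γ', z] = ψ z :=
  cycleInduced_of_algebraicSimilitude hB hS η p x hM hY ηY pY xY hMY γ hγalg hφrat hφtyp hφT hφonto hm hφmul ψ
    hψT (fun y _ hy ↦ hψrat y hy) (fun i j y _ hy ↦ hψtyp i j y hy) hψsq hψmul

end Summit.HodgeConjecture.HodgeConjecture.Theorems.MarkmanPartnerTransport.QuotientSimilitude

end
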